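import Mathlib
import HarnessLib
import Summits.ValiantsHypothesis.ValiantsHypothesis.Theses.MonotoneRestoration
import Literature.Computability.AlgebraicComplexity.ArithCircuit
import Summits.ValiantsHypothesis.ValiantsHypothesis.Theorems.MonotoneRestorationMonotoneRestorationQPCosetCount
import Summits.ValiantsHypothesis.ValiantsHypothesis.Theorems.MonotoneRestorationMonotoneRestorationQPSupportSymmetrisation

/-!
# Skeleton — crux `MonotoneRestorationQP`, line `interval-blocks` (strategist, 2026-08-17)

Crux item `stmt-ValiantsHypothesis-15886`
(`Summit.ValiantsHypothesis.ValiantsHypothesis.Theses.MonotoneRestoration.MonotoneRestorationQP`).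

The registered line `Sketch` has ONE open stub, S5 = `stub_monotoneSupportReduction`
(poly monotone complexity ⇒ a polylog-SUPPORT program over `ℂ`), which is crux-equivalent
(supported programs over `ℂ` are rigidified symmetric circuits: S3 and its converse via the
Dawar–Wilsenach support theorem). This line cuts S5 at a genuinely intermediate object:

**interval-block monotone circuits.** A fan-in-two circuit over the semiring `ℝ≥0` on the
`n × n` variable matrix is `B`-INTERVAL-BLOCK if the polynomial at every gate is invariant under
`S_{I₁} × ⋯ × S_{I_B}` acting on the ROWS and `S_{J₁} × ⋯ × S_{J_B}` acting on the COLUMNS, for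
some partitions of `Fin n` into at most `B` INTERVALS each (gate-dependent partitions; typed as
monotone colourings `κ μ : Fin n → Fin B`, invariance under every colour-preserving `σ × τ`).
Small SUPPORT `K` (the currency of S5) is the special case "singletons of `K` + the gaps between
them" (`≤ 2|K|+1` intervals); but prefix products `∏_{i ≤ m} (Σ_j x_ij)` have 2 blocks and support
`m`, so blocks are strictly more general than supports, and every monotone algorithm on record for
a matrix-symmetric family (prefix / 2D dynamic programmes, lexicographically ordered orbit sums and
orbit products, tree-decomposition DPs with polylog pins, role-subset DPs) is natively
polylog-interval-block.

* `stub_intervalBlockReduction` (Q, canonicalisation — monotone circuits only, no symmetric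
  circuits): a matrix-symmetric family of polynomial degree and polynomial monotone complexity has
  quasi-polynomial-size fan-in-two monotone circuits all of whose gates are
  `(log₂ n + c)^c`-interval-block (and of quasi-polynomial degree). "Monotone symmetry-breaking is
  without loss of generality symmetry-breaking along ONE linear order with polylog cut points."
* `stub_blocksToSupports` (P, structured restoration — interval-block circuits only, no arbitrary
  monotone circuits): such a circuit is re-expressed as a polylog-SUPPORT program over `ℂ`
  (exactly the normal form consumed by the LANDED S3 `stub_supportSymmetrisation`): every gate is
  a multisymmetric function of ≤ polylog blocks of row-vectors / column-vectors, and the engines are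
  interpolation / Newton in the block power sums (`newton_prod_eq_aeval_psum`, landed) and the
  commuting-transfer normal form of exchangeable row scans (card apolar-commuting-transfer, the
  2-block case).
* `MonotoneRestorationQP_of` — the composition through the landed S3 (`stub_supportSymmetrisation`)
  and S1 (`stub_cosetCount`) and the size bookkeeping `supportReduction_size_le` (copied from
  `Lines/Sketch.lean`, lead prover-line-stmt-ValiantsHypothesis-15886-0).

Relation to the crux: P is implied by the quasi-polynomial form of the crux (an interval-block
monotone circuit is a monotone circuit); Q is not implied by the crux (it speaks of monotone
circuits only) — it is the line's bet, falsifiable by ONE matrix-symmetric monotone-easy family all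
of whose polylog-interval-block monotone circuits are large (blocks give canonical rectangles, so
lower bounds against interval-block monotone circuits are within reach of the tree's
`ArithCircuit.exists_balanced_decomposition`).
-/

set_option linter.dupNamespace false

namespace Summit.ValiantsHypothesis.ValiantsHypothesis.Cruxes.MonotoneRestorationQP.IntervalBlocks

open Summit.ValiantsHypothesis.ValiantsHypothesis.Theses.MonotoneRestoration
open Summit.ValiantsHypothesis.ValiantsHypothesis.Theorems
open Literature.Computability.AlgebraicComplexity

/-- **Q — INTERVAL-BLOCK REDUCTION (canonicalisation of monotone circuits for matrix-symmetric
families).** A matrix-symmetric family over `ℝ≥0` of polynomial degree and polynomial monotone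
complexity is computed by well-formed fan-in-two circuits over `ℝ≥0` of size `≤ 2^((log₂ n + c)^c)`
in which every gate value has total degree `≤ 2^((log₂ n + c)^c)` and is invariant under
`σ × τ` for all row permutations `σ` preserving a monotone colouring `κ : Fin n → Fin ((log₂ n + c)^c)`
and all column permutations `τ` preserving a monotone colouring `μ` (colourings depend on the
gate; monotone = colour classes are intervals). [conjecture-grade: not implied by the crux; no
counterexample among the 27 census families of C5-memo-1, all natively interval-block] -/
theorem stub_intervalBlockReduction :
    ∀ f : (n : ℕ) → MvPolynomial (Fin n × Fin n) NNReal,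
    (∀ (n : ℕ) (σ τ : Equiv.Perm (Fin n)),
      MvPolynomial.rename (fun p : Fin n × Fin n => (σ p.1, τ p.2)) (f n) = f n) →
    (∃ c : ℕ, ∀ n : ℕ, (f n).totalDegree ≤ (n + 2) ^ c ∧
      complexity (k := NNReal) (f n) ≤ (n + 2) ^ c) →
    ∃ c : ℕ, ∀ n : ℕ, ∃ P : ArithCircuit NNReal (Fin n × Fin n),
      P.IsFanInTwo ∧ P.WellFormed ∧ P.eval = f n ∧
      P.size ≤ 2 ^ ((Nat.log 2 n + c) ^ c) ∧
      ∀ i : ℕ, i < P.size →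
        ((ArithCircuit.gateValues P.gates).getD i 0).totalDegree ≤ 2 ^ ((Nat.log 2 n + c) ^ c) ∧
        ∃ κ μ : Fin n → Fin ((Nat.log 2 n + c) ^ c), Monotone κ ∧ Monotone μ ∧
          ∀ σ τ : Equiv.Perm (Fin n), (∀ x, κ (σ x) = κ x) → (∀ x, μ (τ x) = μ x) →
            MvPolynomial.rename (fun p : Fin n × Fin n => (σ p.1, τ p.2))
              ((ArithCircuit.gateValues P.gates).getD i 0) =
              (ArithCircuit.gateValues P.gates).getD i 0 := by
  sorry

/-- **P — FROM INTERVAL BLOCKS TO POLYLOG SUPPORTS (structured restoration).** A matrix-symmetric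
family over `ℝ≥0` computed by quasi-polynomial interval-block monotone circuits (the conclusion of
`stub_intervalBlockReduction`, verbatim) is computed, after complexification, by supported
straight-line programs over `ℂ` of support width `≤ (log₂ n + c)^c`, size and fan-in
`≤ 2^((log₂ n + c)^c)` — the normal form of the landed S3 `stub_supportSymmetrisation`
(non-nullary gates, well formed, supports `K i`, product operands supported inside `K i`, gate
values invariant under the pointwise stabiliser of `K i` in the diagonal action, output gate of
empty support). Every gate of the hypothesis is a multisymmetric polynomial in `≤ polylog` blocks of
row-vectors and column-vectors; the engines are Newton / interpolation in block power sums
(`newton_prod_eq_aeval_psum`) and the commuting-transfer normal form of exchangeable row scans.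
Implied by the quasi-polynomial form of the crux. [conjecture-grade] -/
theorem stub_blocksToSupports :
    ∀ f : (n : ℕ) → MvPolynomial (Fin n × Fin n) NNReal,
    (∀ (n : ℕ) (σ τ : Equiv.Perm (Fin n)),
      MvPolynomial.rename (fun p : Fin n × Fin n => (σ p.1, τ p.2)) (f n) = f n) →
    (∃ c : ℕ, ∀ n : ℕ, ∃ P : ArithCircuit NNReal (Fin n × Fin n),
      P.IsFanInTwo ∧ P.WellFormed ∧ P.eval = f n ∧
      P.size ≤ 2 ^ ((Nat.log 2 n + c) ^ c) ∧
      ∀ i : ℕ, i < P.size →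
        ((ArithCircuit.gateValues P.gates).getD i 0).totalDegree ≤ 2 ^ ((Nat.log 2 n + c) ^ c) ∧
        ∃ κ μ : Fin n → Fin ((Nat.log 2 n + c) ^ c), Monotone κ ∧ Monotone μ ∧
          ∀ σ τ : Equiv.Perm (Fin n), (∀ x, κ (σ x) = κ x) → (∀ x, μ (τ x) = μ x) →
            MvPolynomial.rename (fun p : Fin n × Fin n => (σ p.1, τ p.2))
              ((ArithCircuit.gateValues P.gates).getD i 0) =
              (ArithCircuit.gateValues P.gates).getD i 0) →
    ∃ c : ℕ, ∀ n : ℕ, ∃ (P : ArithCircuit ℂ (Fin n × Fin n)) (K : ℕ → Finset (Fin n)),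
      (∀ g ∈ P.gates, g.args ≠ []) ∧ (∀ g ∈ P.gates, g.fanIn ≤ 2 ^ ((Nat.log 2 n + c) ^ c)) ∧
      P.WellFormed ∧ (∀ i, (K i).card ≤ (Nat.log 2 n + c) ^ c) ∧
      (∀ (i : ℕ) (us : List (ArithCircuit.Operand ℂ (Fin n × Fin n))),
        P.gates[i]? = some (.prod us) → ∀ u ∈ us,
          match u with
          | .var pq => pq.1 ∈ K i ∧ pq.2 ∈ K i
          | .const _ => True
          | .gate j => K j ⊆ K i) ∧
      (∀ (i : ℕ) (σ : Equiv.Perm (Fin n)), i < P.size → (∀ x ∈ K i, σ x = x) →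
        MvPolynomial.rename (fun pq : Fin n × Fin n => (σ pq.1, σ pq.2))
          ((ArithCircuit.gateValues P.gates).getD i 0) =
          (ArithCircuit.gateValues P.gates).getD i 0) ∧
      (∃ j, P.output = .gate j ∧ j < P.size ∧ K j = ∅) ∧
      P.size ≤ 2 ^ ((Nat.log 2 n + c) ^ c) ∧
      P.eval = MvPolynomial.map (Complex.ofRealHom.comp NNReal.toRealHom) (f n) := by
  sorry

/-- Size bookkeeping for the composition (copied from `Lines/Sketch.lean`, lead
prover-line-stmt-ValiantsHypothesis-15886-0): with `M = (log₂ n + c)^c`,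
`3 (2^M + 1)(2·2^M + 1)(n + 1)^(M + 2) ≤ 2^((log₂ n + c')^c')` for `c' = c + 4`. [folklore] -/
theorem supportReduction_size_le (c : ℕ) : ∃ c' : ℕ, ∀ n : ℕ,
    3 * (2 ^ ((Nat.log 2 n + c) ^ c) + 1) * (2 * 2 ^ ((Nat.log 2 n + c) ^ c) + 1) *
      (n + 1) ^ ((Nat.log 2 n + c) ^ c + 2) ≤ 2 ^ ((Nat.log 2 n + c') ^ c') := by
  refine ⟨c + 4, fun n => ?_⟩
  have hL : n < 2 ^ (Nat.log 2 n + 1) := Nat.lt_pow_succ_log_self Nat.one_lt_two n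
  generalize Nat.log 2 n = L at hL ⊢
  set M : ℕ := (L + c) ^ c with hM
  set B : ℕ := L + (c + 4) with hB
  have hB4 : 4 ≤ B := by omega
  have hB1 : 1 ≤ B := by omega
  have hMB : M ≤ B ^ c := Nat.pow_le_pow_left (by omega) c
  have h1 : 3 * (2 ^ M + 1) ≤ 2 ^ (M + 3) := by
    have : 1 ≤ 2 ^ M := Nat.one_le_two_pow
    have h' : 2 ^ (M + 3) = 2 ^ M * 8 := by rw [pow_add]; norm_num
    omega
  have h2 : 2 * 2 ^ M + 1 ≤ 2 ^ (M + 2) := by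
    have : 1 ≤ 2 ^ M := Nat.one_le_two_pow
    have h' : 2 ^ (M + 2) = 2 ^ M * 4 := by rw [pow_add]; norm_num
    omega
  have h3 : (n + 1) ^ (M + 2) ≤ 2 ^ ((L + 1) * (M + 2)) := by
    have hn1 : n + 1 ≤ 2 ^ (L + 1) := hL
    calc (n + 1) ^ (M + 2) ≤ (2 ^ (L + 1)) ^ (M + 2) := Nat.pow_le_pow_left hn1 _
      _ = 2 ^ ((L + 1) * (M + 2)) := (pow_mul 2 (L + 1) (M + 2)).symm
  have hE : (M + 3) + (M + 2) + (L + 1) * (M + 2) ≤ B ^ (c + 4) := by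
    have hLB : L + 1 ≤ B := by omega
    have hBc2 : B ^ (c + 1) * B = B ^ (c + 2) := (pow_succ B (c + 1)).symm
    have hBc3 : B ^ (c + 2) * B = B ^ (c + 3) := (pow_succ B (c + 2)).symm
    have hstep1 : (M + 3) + (M + 2) + (L + 1) * (M + 2) ≤ (B + 2) * (B ^ c + B) := by
      calc (M + 3) + (M + 2) + (L + 1) * (M + 2)
          ≤ (B ^ c + B) + (B ^ c + B) + B * (B ^ c + B) := by
            have : (L + 1) * (M + 2) ≤ B * (B ^ c + B) :=
              Nat.mul_le_mul hLB (by omega)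
            omega
        _ = (B + 2) * (B ^ c + B) := by ring
    have hstep2 : (B + 2) * (B ^ c + B) ≤ B ^ (c + 4) := by
      have hB2 : B + 2 ≤ 2 * B := by omega
      have hBcB : B ^ c + B ≤ 2 * B ^ (c + 1) := by
        have : B ≤ B ^ (c + 1) := by
          calc B = B ^ 1 := (pow_one B).symm
            _ ≤ B ^ (c + 1) := Nat.pow_le_pow_right hB1 (by omega)
        have : B ^ c ≤ B ^ (c + 1) := Nat.pow_le_pow_right hB1 (by omega)
        omega
      calc (B + 2) * (B ^ c + B) ≤ (2 * B) * (2 * B ^ (c + 1)) := Nat.mul_le_mul hB2 hBcB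
        _ = 4 * (B ^ (c + 1) * B) := by ring
        _ = 4 * B ^ (c + 2) := by rw [hBc2]
        _ ≤ B * B ^ (c + 2) := Nat.mul_le_mul_right _ hB4
        _ = B ^ (c + 3) := by rw [mul_comm, hBc3]
        _ ≤ B ^ (c + 4) := Nat.pow_le_pow_right hB1 (by omega)
    exact hstep1.trans hstep2
  calc 3 * (2 ^ M + 1) * (2 * 2 ^ M + 1) * (n + 1) ^ (M + 2)
      ≤ 2 ^ (M + 3) * 2 ^ (M + 2) * 2 ^ ((L + 1) * (M + 2)) :=
        Nat.mul_le_mul (Nat.mul_le_mul h1 h2) h3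
    _ = 2 ^ ((M + 3) + (M + 2) + (L + 1) * (M + 2)) := by rw [← pow_add, ← pow_add]
    _ ≤ 2 ^ (B ^ (c + 4)) := Nat.pow_le_pow_right (by norm_num) hE

/-- **Composition.** `MonotoneRestorationQP` from Q (`stub_intervalBlockReduction`), P
(`stub_blocksToSupports`), the LANDED coset-block symmetrisation S3 (`stub_supportSymmetrisation`,
fed the landed counting lemma S1 `stub_cosetCount`) and the size bookkeeping
`supportReduction_size_le`. [folklore] -/
theorem MonotoneRestorationQP_of : MonotoneRestorationQP := by
  intro f hsym hcplx
  obtain ⟨c, hc⟩ := stub_blocksToSupports f hsym (stub_intervalBlockReduction f hsym hcplx)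
  obtain ⟨c', hc'⟩ := supportReduction_size_le c
  refine ⟨c', fun n => ?_⟩
  obtain ⟨P, K, hne, hA, hwf, hk, hprod, hinv, hout, hsize, heval⟩ := hc n
  obtain ⟨G, inst, C, hCs, hCe, hCc⟩ :=
    stub_supportSymmetrisation n ((Nat.log 2 n + c) ^ c) (2 ^ ((Nat.log 2 n + c) ^ c)) P K hne hA
      hwf hk hprod hinv hout (stub_cosetCount n)
  refine ⟨G, inst, C, hCs, hCe.trans heval, hCc.trans (le_trans ?_ (hc' n))⟩
  have hs : P.size + 1 ≤ 2 ^ ((Nat.log 2 n + c) ^ c) + 1 := by omega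
  exact Nat.mul_le_mul_right _ (Nat.mul_le_mul_right _ (Nat.mul_le_mul_left 3 hs))

end Summit.ValiantsHypothesis.ValiantsHypothesis.Cruxes.MonotoneRestorationQP.IntervalBlocks
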